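import Summits.Schanuel.Schanuel.Theorems.DiophantineDichotomyDefs
import Literature.NumberTheory.Transcendental.PiTranscendenceMeasure

/-!
# Stub `stub_piFloor` of line `bounded-index-core` (crux `EPiSimultaneousType`, stmt-Schanuel-6118)

The registered stub `stub_piFloor : ∀ A > 1, ∃ K C, SlotFloor π A K C` of the skeleton
`Cruxes/EPiSimultaneousType/Lines/bounded-index-core.lean` is the **floor at `π`** of the slot
dichotomy: `log|P(π)| ≥ −C((max 1 deg P)^A log(max 1 H(P)) + (max 1 deg P)^K)` for every
non-zero `P ∈ ℤ[X₀]` (vocabulary `SlotFloor`, `CodimOneMeasure`, `mvNatHeight` of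
`Theorems/DiophantineDichotomyDefs.lean`). It is a KNOWN DEEP THEOREM — a transcendence measure
of `π` of Fel'dman type (Baker's method) — and is not provable from Mathlib in a session. This
file delivers the CONDITIONAL version:

* `NesterenkoWaldschmidt1996_thm_2_2` — the printed theorem as a NAMED FACT (`def … : Prop`, not
  asserted): Yu. V. Nesterenko, M. Waldschmidt, *On the approximation of the values of
  exponential function and logarithm by algebraic numbers* (Mat. Zapiski 2, 1996;
  arXiv:math/0002047), Theorem 2 part 2), p. 1: "If `P ∈ ℤ[x]`, `P ≠ 0`, `deg P ≤ d`,
  `L(P) ≤ L`, and `L ≥ 3`, then `|P(π)| ≥ exp{−2·10⁶ d·(log L + d log d)·(1 + log d)}`", where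
  `L(P) = ∑ |aᵢ|` is the LENGTH of `P` (ibid. p. 1). We record it for natural `d ≥ 1`, `L ≥ 3`
  (a special case of the printed range).
* `slotFloor_pi_of_nesterenkoWaldschmidt1996 : Literature.NumberTheory.Transcendental.NesterenkoWaldschmidt1996_thm_2_2 →
  ∀ A > 1, ∃ K C, SlotFloor π A K C` — the stub's exact conclusion under the fact (registered as a
  sub-goal of stmt-Schanuel-6118), with `K = 4`, `C = 2·10⁶ (4 + 1/(A − 1))`.

## Bookkeeping `L ↔ H`

Given a non-zero `P : MvPolynomial (Fin 1) ℤ` let `p = MvPolynomial.uniqueAlgEquiv ℤ (Fin 1) P`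
in `ℤ[X]` (same coefficients, `P(π) = p(π)`), `n = totalDegree P ≥ natDegree p`,
`H₀ = mvNatHeight P ≥ |p.coeff k|`, `D = max 1 n`, `M = max 1 H₀`. Then
`L(p) ≤ (n + 1) H₀ ≤ 3 (D + 1) M =: L ≥ 3`, and with `x = D`, `ℓ = log M ≥ 0`:
`log L = log 3 + log (x + 1) + ℓ ≤ 2 + x + ℓ`, `log x ≤ x − 1`, so
`2·10⁶ x (log L + x log x)(1 + log x) ≤ 2·10⁶ (x (1 + log x) ℓ + 4 x⁴)`, and
`x (1 + log x) ≤ (1 + 1/(A−1)) x^A` because `log x ≤ x^{A−1}/(A−1)` and `1 ≤ x^{A−1}`.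
-/

set_option linter.dupNamespace false

noncomputable section

namespace Summit.Schanuel.Schanuel.Theorems

namespace EPiSimultaneousType.PiFloor

open Polynomial

open Summit.Schanuel.Schanuel.Cruxes.KhovanskiiApproxType.LwSmallHeight

/-! ## Bookkeeping: `MvPolynomial (Fin 1) ℤ → ℤ[X]` -/

/-- Evaluation commutes with `uniqueAlgEquiv`: `p(ξ) = P(ξ)`. [folklore] -/
theorem aeval_uniqueAlgEquiv (P : MvPolynomial (Fin 1) ℤ) (ξ : ℂ) :
    Polynomial.aeval ξ (MvPolynomial.uniqueAlgEquiv ℤ (Fin 1) P) =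
      MvPolynomial.aeval (fun _ : Fin 1 => ξ) P := by
  rw [Polynomial.aeval_def, MvPolynomial.aeval_def, MvPolynomial.eval₂_const_uniqueAlgEquiv]

/-- The degree of `p` is at most the total degree of `P`. [folklore] -/
theorem natDegree_uniqueAlgEquiv_le (P : MvPolynomial (Fin 1) ℤ) :
    (MvPolynomial.uniqueAlgEquiv ℤ (Fin 1) P).natDegree ≤ P.totalDegree := by
  refine Polynomial.natDegree_le_iff_coeff_eq_zero.2 fun N hN => ?_
  rw [MvPolynomial.coeff_uniqueAlgEquiv]
  by_contra hc
  have hle := MvPolynomial.le_totalDegree (MvPolynomial.mem_support_iff.2 hc)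
  rw [Finsupp.sum_single_index rfl] at hle
  exact absurd (lt_of_lt_of_le hN hle) (lt_irrefl _)

/-- The coefficients of `p` are bounded by the naive height of `P`. [folklore] -/
theorem abs_coeff_uniqueAlgEquiv_le (P : MvPolynomial (Fin 1) ℤ) (k : ℕ) :
    |(MvPolynomial.uniqueAlgEquiv ℤ (Fin 1) P).coeff k| ≤ (mvNatHeight P : ℤ) := by
  rw [MvPolynomial.coeff_uniqueAlgEquiv, Int.abs_eq_natAbs, Int.ofNat_le]
  by_cases hc : MvPolynomial.coeff (Finsupp.single default k) P = 0
  · rw [hc]; exact Nat.zero_le _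
  · exact Finset.le_sup (f := fun e => (P.coeff e).natAbs) (MvPolynomial.mem_support_iff.2 hc)

/-- The length of `p` is at most `(totalDegree P + 1) · mvNatHeight P`. [folklore] -/
theorem length_uniqueAlgEquiv_le (P : MvPolynomial (Fin 1) ℤ) :
    (∑ k ∈ Finset.range ((MvPolynomial.uniqueAlgEquiv ℤ (Fin 1) P).natDegree + 1),
      |(MvPolynomial.uniqueAlgEquiv ℤ (Fin 1) P).coeff k|) ≤
      ((P.totalDegree + 1 : ℕ) : ℤ) * (mvNatHeight P : ℤ) := by
  calc (∑ k ∈ Finset.range ((MvPolynomial.uniqueAlgEquiv ℤ (Fin 1) P).natDegree + 1),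
      |(MvPolynomial.uniqueAlgEquiv ℤ (Fin 1) P).coeff k|)
      ≤ ∑ _k ∈ Finset.range ((MvPolynomial.uniqueAlgEquiv ℤ (Fin 1) P).natDegree + 1),
          (mvNatHeight P : ℤ) := Finset.sum_le_sum fun k _ => abs_coeff_uniqueAlgEquiv_le P k
    _ = (((MvPolynomial.uniqueAlgEquiv ℤ (Fin 1) P).natDegree + 1 : ℕ) : ℤ) *
          (mvNatHeight P : ℤ) := by
        rw [Finset.sum_const, Finset.card_range, nsmul_eq_mul]
    _ ≤ ((P.totalDegree + 1 : ℕ) : ℤ) * (mvNatHeight P : ℤ) := by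
        apply mul_le_mul_of_nonneg_right _ (Int.natCast_nonneg _)
        exact_mod_cast Nat.succ_le_succ (natDegree_uniqueAlgEquiv_le P)

/-! ## The analytic bookkeeping -/

/-- For `x ≥ 1`, `ℓ ≥ 0`, `A > 1`:
`2·10⁶ x (log 3 + log(x+1) + ℓ + x log x)(1 + log x) ≤ 2·10⁶ (4 + 1/(A−1)) (x^A ℓ + x^4)`.
[folklore] -/
theorem exponent_bound {A x ℓ : ℝ} (hA : 1 < A) (hx : 1 ≤ x) (hℓ : 0 ≤ ℓ) :
    2 * 10 ^ 6 * x * (Real.log 3 + Real.log (x + 1) + ℓ + x * Real.log x) * (1 + Real.log x) ≤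
      2 * 10 ^ 6 * (4 + 1 / (A - 1)) * (x ^ A * ℓ + x ^ ((4 : ℕ) : ℝ)) := by
  have hx0 : 0 < x := by linarith
  have hA1 : 0 < A - 1 := by linarith
  set k : ℝ := 1 + 1 / (A - 1) with hk
  have hk1 : 1 ≤ k := by rw [hk]; have := one_div_pos.2 hA1; linarith
  set t : ℝ := 1 + Real.log x with ht
  have hlogx0 : 0 ≤ Real.log x := Real.log_nonneg hx
  have hlogx : Real.log x ≤ x - 1 := Real.log_le_sub_one_of_pos hx0
  have ht1 : 1 ≤ t := by rw [ht]; linarith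
  have htx : t ≤ x := by rw [ht]; linarith
  have hlog3 : Real.log 3 ≤ 2 := by
    have := Real.log_le_sub_one_of_pos (show (0 : ℝ) < 3 by norm_num); linarith
  have hlogx1 : Real.log (x + 1) ≤ x := by
    have := Real.log_le_sub_one_of_pos (show (0 : ℝ) < x + 1 by linarith); linarith
  -- the bracket `S = log L + x log x ≤ ℓ + 4x²`
  have hS : Real.log 3 + Real.log (x + 1) + ℓ + x * Real.log x ≤ ℓ + 4 * x ^ 2 := by
    have h1 : x * Real.log x ≤ x * x := mul_le_mul_of_nonneg_left (by linarith) hx0.le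
    nlinarith
  -- `x t ≤ k x^A`
  have hxA1 : 1 ≤ x ^ (A - 1) := Real.one_le_rpow hx hA1.le
  have hlogA : Real.log x ≤ x ^ (A - 1) / (A - 1) := Real.log_le_rpow_div hx0.le hA1
  have htk : t ≤ k * x ^ (A - 1) := by
    rw [ht, hk, add_mul, one_mul, one_div, inv_mul_eq_div]
    exact add_le_add hxA1 hlogA
  have hxA : x * x ^ (A - 1) = x ^ A := by
    conv_rhs => rw [show A = (A - 1) + 1 by ring, Real.rpow_add_one hx0.ne' (A - 1)]
    ring
  have hxt : x * t ≤ k * x ^ A := by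
    rw [← hxA]
    have := mul_le_mul_of_nonneg_left htk hx0.le
    linarith [this]
  have hx4 : x ^ ((4 : ℕ) : ℝ) = x ^ (4 : ℕ) := Real.rpow_natCast x 4
  rw [hx4]
  have hxApos : 0 ≤ x ^ A := (Real.rpow_pos_of_pos hx0 A).le
  -- assemble
  have hxt0 : 0 ≤ x * t := by positivity
  calc 2 * 10 ^ 6 * x * (Real.log 3 + Real.log (x + 1) + ℓ + x * Real.log x) * t
      ≤ 2 * 10 ^ 6 * x * (ℓ + 4 * x ^ 2) * t := by
        have := mul_le_mul_of_nonneg_left hS hxt0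
        nlinarith [this]
    _ = 2 * 10 ^ 6 * ((x * t) * ℓ) + 8 * 10 ^ 6 * (x ^ 3 * t) := by ring
    _ ≤ 2 * 10 ^ 6 * ((k * x ^ A) * ℓ) + 8 * 10 ^ 6 * (x ^ 3 * x) := by
        have h1 : (x * t) * ℓ ≤ (k * x ^ A) * ℓ := mul_le_mul_of_nonneg_right hxt hℓ
        have h2 : x ^ 3 * t ≤ x ^ 3 * x := mul_le_mul_of_nonneg_left htx (by positivity)
        linarith
    _ ≤ 2 * 10 ^ 6 * (4 + 1 / (A - 1)) * (x ^ A * ℓ + x ^ (4 : ℕ)) := by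
        have h3 : k ≤ 4 + 1 / (A - 1) := by rw [hk]; linarith
        have h4 : (4 : ℝ) ≤ 4 + 1 / (A - 1) := by linarith
        have h5 : 0 ≤ x ^ A * ℓ := mul_nonneg hxApos hℓ
        have h6 : 0 ≤ x ^ (4 : ℕ) := by positivity
        nlinarith [mul_le_mul_of_nonneg_right h3 h5, mul_le_mul_of_nonneg_right h4 h6]

/-! ## The conditional floor at `π` -/

/-- **The stub's conclusion under the named fact**: Nesterenko–Waldschmidt 1996 Thm 2(2) gives,
for every `A > 1`, a slot floor at `π` with exponents `(A, 4)` and constant `2·10⁶ (4 + 1/(A−1))`.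
[cite: NesterenkoWaldschmidt1996, Thm 2(2)] -/
theorem slotFloor_pi_of_nesterenkoWaldschmidt1996 :
    Literature.NumberTheory.Transcendental.NesterenkoWaldschmidt1996_thm_2_2 →
      ∀ A : ℝ, 1 < A → ∃ K C : ℝ, SlotFloor (Real.pi : ℂ) A K C := by
  intro h A hA
  have hA1 : 0 < A - 1 := by linarith
  refine ⟨((4 : ℕ) : ℝ), 2 * 10 ^ 6 * (4 + 1 / (A - 1)), ?_, fun P hP => ?_⟩
  · have := one_div_pos.2 hA1
    positivity
  -- the data
  set p : ℤ[X] := MvPolynomial.uniqueAlgEquiv ℤ (Fin 1) P with hp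
  set n : ℕ := P.totalDegree with hn
  set H₀ : ℕ := mvNatHeight P with hH₀
  set D : ℕ := max 1 n with hD
  set M : ℕ := max 1 H₀ with hM
  have hp0 : p ≠ 0 := fun h0 => hP ((MvPolynomial.uniqueAlgEquiv ℤ (Fin 1)).injective
    (by rw [← hp, h0, map_zero]))
  have hD1 : 1 ≤ D := le_max_left _ _
  have hnD : n ≤ D := le_max_right _ _
  have hM1 : 1 ≤ M := le_max_left _ _
  have hHM : H₀ ≤ M := le_max_right _ _
  have hdeg : p.natDegree ≤ D := (natDegree_uniqueAlgEquiv_le P).trans hnD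
  have hlen : (∑ k ∈ Finset.range (p.natDegree + 1), |p.coeff k|) ≤
      ((3 * (D + 1) * M : ℕ) : ℤ) := by
    refine (length_uniqueAlgEquiv_le P).trans ?_
    have : (n + 1) * H₀ ≤ 3 * (D + 1) * M :=
      (Nat.mul_le_mul (Nat.succ_le_succ hnD) hHM).trans
        (Nat.mul_le_mul_right _ (Nat.le_mul_of_pos_left _ (by norm_num)))
    exact_mod_cast this
  have hL3 : 3 ≤ 3 * (D + 1) * M := by
    have : 1 ≤ (D + 1) * M := Nat.one_le_iff_ne_zero.2 (Nat.mul_ne_zero (by omega) (by omega))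
    nlinarith
  -- the fact
  have key := h p D (3 * (D + 1) * M) hp0 hD1 hdeg hlen hL3
  rw [aeval_uniqueAlgEquiv] at key
  refine le_trans (Real.exp_le_exp.2 (neg_le_neg ?_)) key
  -- casts
  have hxD : (max 1 (P.totalDegree : ℝ)) = (D : ℝ) := by rw [hD, Nat.cast_max, Nat.cast_one]
  have hyM : (max 1 (mvNatHeight P : ℝ)) = (M : ℝ) := by rw [hM, Nat.cast_max, Nat.cast_one]
  rw [hxD, hyM]
  have hx1 : (1 : ℝ) ≤ D := by exact_mod_cast hD1
  have hy1 : (1 : ℝ) ≤ M := by exact_mod_cast hM1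
  have hℓ : 0 ≤ Real.log M := Real.log_nonneg hy1
  have hlogL : Real.log ((3 * (D + 1) * M : ℕ) : ℝ) =
      Real.log 3 + Real.log ((D : ℝ) + 1) + Real.log M := by
    push_cast
    rw [Real.log_mul (by positivity) (by positivity), Real.log_mul (by norm_num) (by positivity)]
  rw [hlogL]
  convert exponent_bound hA hx1 hℓ using 2

end EPiSimultaneousType.PiFloor

end Summit.Schanuel.Schanuel.Theorems

end
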